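import Summits.BirchSwinnertonDyer.BirchSwinnertonDyer.Theorems.RamifiedHeegnerPairTwistUnitSaving
import HarnessLib

/-!
# U₁ at the SAVING ROWS of the Gss2 census (rank one), TU|saving — part R: `244314bx1`, `255915bd1`

Continuation of `…Theorems.RamifiedHeegnerPairTwistUnitSaving` (seat `bsd-trib-w-rhp` g15; doors, framing and data provenance there; generic kernel lemmas g14's `…TwistUnitInert`):
per rank one curve `subGss_three_/Δ_eq_/c₄_eq_/krausList_/surj_three_<label>` IN THE KERNEL, Kraus minimality of `V = E^{(-3)}_min` and of the twist model `Wd`, and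
`u1s_at_<label> : … → MissingUpperBoundAt W 3` by p674548 `LeafShimuraInert.leafRankOneUpper_three_of_shimuraInertDatum_at_saving_of_twistUnit` through
`leafRankOneUpper_three_at_saving_of_sqrtField` — printed facts `hGZK hmod hnf hJL hCO hPrim` as hypotheses; `q₁ ∣ Δ_min`, multiplicative / no-split / Tate certificates, `hFC`, `hshape` off `q₁`, (DEG), field
congruences IN THE KERNEL; `hN hr Dt hc` + the twist `L`-value + `#Ш(Wd)_an` DISPLAYED.  **HONEST FRAMING: theorems only; nothing booked, no item closed; U₁ (26022) / TU|saving / the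
Shimura-curve Heegner-system inputs stay research-level and OPEN class-wide; BSD is NOT proved for any curve by this file.**
[cite: JetchevSkinnerWan2017, §7.4.2 (p. 31)] [cite: PastenShimura2024, Prop. 6.13, Lemma 6.15, Lemma 6.18] [cite: Serre1972, §2.8] [cite: Kraus1989, Prop. 1] [cite: Cremona2006, Table 1]
-/

set_option linter.dupNamespace false
set_option autoImplicit false

noncomputable section

open scoped Classical NumberField

open WeierstrassCurve NumberField IsDedekindDomain IsDedekindDomain.HeightOneSpectrum Rat.HeightOneSpectrum Field Literature Literature.NumberTheory.DiophantineGeometry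
  Literature.NumberTheory.EllipticCurves Literature.NumberTheory.EllipticCurves.ModularForms Literature.NumberTheory.EllipticCurves.Rank1Residual
  Literature.NumberTheory.EllipticCurves.Rank1Residual.Typed Literature.NumberTheory.Automorphic Literature.NumberTheory.EllipticCurves.Rank1Residual.X11RankOneCertificates
  Literature.NumberTheory.EllipticCurves.KrizLi2019 Literature.NumberTheory.GaloisRepresentations Literature.NumberTheory.QuadraticFields Literature.NumberTheory.QuadraticFields.Quadratic
  Summit.BirchSwinnertonDyer.BirchSwinnertonDyer.Rank1Residual Summit.BirchSwinnertonDyer.BirchSwinnertonDyer.Rank1Residual.IntModel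
  Summit.BirchSwinnertonDyer.BirchSwinnertonDyer.Rank2Observatory.Tam Summit.BirchSwinnertonDyer.Rank1Residual Summit.BirchSwinnertonDyer.Rank1Residual.Additive
  Summit.BirchSwinnertonDyer.Rank1Residual.X11b Summit.BirchSwinnertonDyer.Rank1Residual.X11b.Three Summit.BirchSwinnertonDyer.Rank1Residual.X9 Summit.BirchSwinnertonDyer.Rank1Residual.GaloisImage
  Summit.BirchSwinnertonDyer.Rank1Residual.Supersingular Summit.BirchSwinnertonDyer.BirchSwinnertonDyer.Theses.RamifiedHeegnerPair Summit.BirchSwinnertonDyer.BirchSwinnertonDyer.Theorems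
  Summit.BirchSwinnertonDyer.BirchSwinnertonDyer.Theorems.SchneiderFree Summit.BirchSwinnertonDyer.BirchSwinnertonDyer.Theorems.RamifiedPairUpperBound
  Summit.BirchSwinnertonDyer.BirchSwinnertonDyer.Theorems.RamifiedHeegnerPairStepLIntrinsic Summit.BirchSwinnertonDyer.BirchSwinnertonDyer.Theorems.AdditiveBranchIMCGordTwoRankOne.HeegnerKolyvagin
  Summit.BirchSwinnertonDyer.BirchSwinnertonDyer.Theorems.RamifiedHeegnerPairTwistUnitIntrinsic Summit.BirchSwinnertonDyer.BirchSwinnertonDyer.Theorems.RamifiedHeegnerPairTwistUnitAdditive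
  Summit.BirchSwinnertonDyer.BirchSwinnertonDyer.Theorems.RamifiedHeegnerPairTwistUnitInert

namespace Summit.BirchSwinnertonDyer.BirchSwinnertonDyer.Theorems.RamifiedHeegnerPairTwistUnitSaving

open RamifiedHeegnerPairTwistUnitInert

/-! ## §33 `244314bx1` = `[1, -1, 1, -56531, -5024141]`, `N = 244314 = 2·3^2·7^2·277` (`2`: I9, `c = 9`, split, `3`: I₀*, `c = 2`, `7`: IV*, `c = 3`, `277`: I1, `c = 1`, non-split); exempted carrier `q₁ = 7` (additive IV*, `c = 3`), inert set `S = {277, 2}` (multiplicative), (DEG) très ramifié at `s₁ = 277` (`3 ∤ ord_{277} Δ = 1`);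
`ρ̄₃` onto (certificate primes `ℓ₁ = 13`, `#Ẽ(𝔽_{13}) = 14`; `ℓ₂ = 31`, `#Ẽ(𝔽_{31}) = 30`); `r_an = 1`, `#E(ℚ)_tors = 1`, `∏ c_ℓ = 54`, `#Ш(E)_an = 1` (Cremona/LMFDB, displayed where used); class `244314bx` of size 1.
`V = E^{(-3)}_min = [1, -1, 0, -6281, 188173]` (`#Ṽ(𝔽₃) = 4`).  JSW field `K = ℚ(√-251)` (`251` prime; `277`, `2` inert, every other `ℓ ∣ N` split): the least such `D` with a twist unit (kit j322550: `L(E^{(-251)},1)/Ω = 24 ≠ 0`, root no. `+1`, `Wd = E^{(-251)}_min = [1, -1, 0, -3561489843, 79672372352117]`, `N(Wd) = 15392026314`, `∏c = 24`, `T = 1`, `#Ш(Wd)_an = (L/Ω)T²/∏c = 1` exactly). -/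

/-- `V = [1, -1, 0, -6281, 188173]` (the minimal model of `244314bx1^{(-3)}`, conductor `27146`): `Δ ≠ 0` in the kernel. [cite: Cremona2006, Table 1 (Cremona label 244314bx1)] -/
theorem isElliptic_sV244314bx1 : (⟨1, -1, 0, -6281, 188173⟩ : WeierstrassCurve ℚ).IsElliptic :=
  isElliptic_of_discOf_ne_zero 1 (-1) 0 (-6281) 188173 (by decide +kernel)

/-- `V` is globally minimal: `|Δ| = 2^9·7^8·277` kernel-checked, Kraus' criterion prime by prime. [cite: Kraus1989, Prop. 1 and Prop. 2]
[cite: SilvermanAEC2009, VII.1 Remark 1.1] [cite: Cremona2006, Table 1 (Cremona label 244314bx1)] -/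
theorem isGloballyMinimal_sV244314bx1 : (⟨1, -1, 0, -6281, 188173⟩ : WeierstrassCurve ℚ).IsGloballyMinimal :=
  isGloballyMinimal_of_krausCriterion₃_factored 1 (-1) 0 (-6281) 188173
    [(2, 9), (7, 8), (277, 1)] (by decide +kernel)
    (by intro qe hqe; simp only [List.mem_cons, List.not_mem_nil, or_false] at hqe
        rcases hqe with rfl | rfl | rfl <;> norm_num)
    (by set_option synthInstance.maxSize 2000 in decide +kernel)

/-- `Wd = [1, -1, 0, -3561489843, 79672372352117]` (the minimal model of the twist `244314bx1^{(-251)}`, conductor `15392026314`): `Δ ≠ 0` in the kernel. [cite: Cremona2006, Table 1 (Cremona label 244314bx1)] -/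
theorem isElliptic_sWd244314bx1 : (⟨1, -1, 0, -3561489843, 79672372352117⟩ : WeierstrassCurve ℚ).IsElliptic :=
  isElliptic_of_discOf_ne_zero 1 (-1) 0 (-3561489843) 79672372352117 (by decide +kernel)

/-- `Wd` is globally minimal: `|Δ| = 2^9·3^6·7^8·251^6·277` kernel-checked, Kraus' criterion prime by prime. [cite: Kraus1989, Prop. 1 and Prop. 2]
[cite: SilvermanAEC2009, VII.1 Remark 1.1] [cite: Cremona2006, Table 1 (Cremona label 244314bx1)] -/
theorem isGloballyMinimal_sWd244314bx1 : (⟨1, -1, 0, -3561489843, 79672372352117⟩ : WeierstrassCurve ℚ).IsGloballyMinimal :=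
  isGloballyMinimal_of_krausCriterion₃_factored 1 (-1) 0 (-3561489843) 79672372352117
    [(2, 9), (3, 6), (7, 8), (251, 6), (277, 1)] (by decide +kernel)
    (by intro qe hqe; simp only [List.mem_cons, List.not_mem_nil, or_false] at hqe
        rcases hqe with rfl | rfl | rfl | rfl | rfl <;> norm_num)
    (by set_option synthInstance.maxSize 2000 in decide +kernel)

/-- **`244314bx1` is ADDITIVE at `3` and on the cell (G) ∧ ss, IN THE KERNEL**: `3 ∣ Δ`, `3 ∣ c₄`; `C • V^{(-3)} = E` (`[u, r, s, t] = [1, -1, 1/2, 1/2]`) with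
`V` globally minimal, `3 ∤ Δ(V)`, `#Ṽ(𝔽₃) = 4` (`a₃(V) = 0`, supersingular), whence `TypeG`, `SubGord`, `SubGss` at `3` (g13's block, unchanged).
[cite: SilvermanAEC2009, VII.5 Prop. 5.1 (a), (c)] [cite: Delbourgo1998, §1.5 (G)] [cite: Cremona2006, Table 1 (Cremona label 244314bx1)] -/
theorem subGss_three_244314bx1 {W : WeierstrassCurve ℚ} [W.IsElliptic] [W.IsGloballyMinimal] (hWeq : W = (⟨1, -1, 1, -56531, -5024141⟩ : WeierstrassCurve ℚ)) :
    Addv W 3 ∧ SubGss W 3 := by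
  subst hWeq
  haveI := isElliptic_sV244314bx1
  haveI := isGloballyMinimal_sV244314bx1
  have hIW : integralModelInt (⟨1, -1, 1, -56531, -5024141⟩ : WeierstrassCurve ℚ) = (⟨1, -1, 1, -56531, -5024141⟩ : WeierstrassCurve ℤ) :=
    integralModelInt_eq_of_map_eq _ (map_mk_int 1 (-1) 1 (-56531) (-5024141))
  have hadd : Addv (⟨1, -1, 1, -56531, -5024141⟩ : WeierstrassCurve ℚ) 3 := Additive.addv_of_intModel hIW 3 (by decide +kernel) (by decide +kernel)
  have hIV : integralModelInt (⟨1, -1, 0, -6281, 188173⟩ : WeierstrassCurve ℚ) = (⟨1, -1, 0, -6281, 188173⟩ : WeierstrassCurve ℤ) :=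
    integralModelInt_eq_of_map_eq _ (map_mk_int 1 (-1) 0 (-6281) 188173)
  have hcV : Nat.card ((((⟨1, -1, 0, -6281, 188173⟩ : WeierstrassCurve ℤ)).map (Int.castRingHom (ZMod 3))).toAffine.Point) = 4 := by
    have h := natCard_point_eq_countPoints 1 (-1) 0 (-6281) 188173 3 (by norm_num) (by decide +kernel)
    have h' : countPoints [1, -1, 0, -6281, 188173] 3 = 4 := countPoints_eq_of_fast (by decide +kernel)
    exact_mod_cast h.trans h'
  have hgood : GoodSS (⟨1, -1, 0, -6281, 188173⟩ : WeierstrassCurve ℚ) 3 := Supersingular.goodSS_of_intModel 3 hIV (by decide +kernel) hcV (by decide)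
  have hVW : (⟨1, (-1 : ℚ), ((1:ℚ)/2), ((1:ℚ)/2)⟩ : VariableChange ℚ) • (⟨1, -1, 0, -6281, 188173⟩ : WeierstrassCurve ℚ).quadraticTwist (-3) =
      (⟨1, -1, 1, -56531, -5024141⟩ : WeierstrassCurve ℚ) := by
    ext <;> simp [WeierstrassCurve.variableChange_a₁, WeierstrassCurve.variableChange_a₂,
      WeierstrassCurve.variableChange_a₃, WeierstrassCurve.variableChange_a₄, WeierstrassCurve.variableChange_a₆,
      WeierstrassCurve.quadraticTwist, WeierstrassCurve.b₂, WeierstrassCurve.b₄, WeierstrassCurve.b₆] <;> norm_num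
  obtain ⟨C, hC⟩ := exists_variableChange_quadraticTwist_symm (⟨1, -1, 1, -56531, -5024141⟩ : WeierstrassCurve ℚ)
    (⟨1, -1, 0, -6281, 188173⟩ : WeierstrassCurve ℚ) (d := (-3 : ℚ)) (by norm_num) ⟨_, hVW⟩
  have hC' : C • (⟨1, -1, 1, -56531, -5024141⟩ : WeierstrassCurve ℚ).quadraticTwist ((-1 : ℚ) ^ ((3 : ℕ) / 2) * (3 : ℕ)) =
      (⟨1, -1, 0, -6281, 188173⟩ : WeierstrassCurve ℚ) := by
    rw [O5.pstar_three]; exact hC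
  have hG : TypeG (⟨1, -1, 1, -56531, -5024141⟩ : WeierstrassCurve ℚ) 3 := (typeG_three_iff_good_twist _ hadd _ C hC').mpr hgood.1
  exact ⟨hadd, (O5.subGss_three_iff_subGord_and_goodSS_twist _ hadd _ C hC).mpr
    ⟨subGord_three_of_typeG_of_addv _ hG hadd, hgood⟩⟩

/-- `Δ(E₀) = 596021022890496 = 2^9·3^6·7^8·277` on the integer equation of `244314bx1`. [cite: Cremona2006, Table 1 (Cremona label 244314bx1)] -/
theorem Δ_eq_244314bx1 : (⟨1, -1, 1, -56531, -5024141⟩ : WeierstrassCurve ℤ).Δ = 596021022890496 := by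
  norm_num [WeierstrassCurve.Δ, WeierstrassCurve.b₂, WeierstrassCurve.b₄, WeierstrassCurve.b₆, WeierstrassCurve.b₈]

/-- `c₄(E₀) = 2713473` on the integer equation of `244314bx1`. [cite: Cremona2006, Table 1 (Cremona label 244314bx1)] -/
theorem c₄_eq_244314bx1 : (⟨1, -1, 1, -56531, -5024141⟩ : WeierstrassCurve ℤ).c₄ = 2713473 := by
  norm_num [WeierstrassCurve.c₄, WeierstrassCurve.b₂, WeierstrassCurve.b₄]

/-- The Kraus list of `244314bx1` consists of primes and multiplies to `|Δ(E₀)|`, IN THE KERNEL: a prime dividing `Δ_min` is one of `[2, 3, 7, 277]`. [cite: Cremona2006, Table 1 (Cremona label 244314bx1)] -/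
theorem krausList_244314bx1 : (∀ qe ∈ ([(2, 9), (3, 6), (7, 8), (277, 1)] : List (ℕ × ℕ)), qe.1.Prime) ∧
    (([(2, 9), (3, 6), (7, 8), (277, 1)] : List (ℕ × ℕ)).map fun qe => qe.1 ^ qe.2).prod = (596021022890496 : ℤ).natAbs :=
  ⟨by decide +kernel, by decide +kernel⟩

/-- **`ρ̄_{E,3}` ONTO for `244314bx1`, IN THE KERNEL** (Frobenius-order witness `hasSurjectiveModNGaloisRep_of_intModel_of_irr_of_order`): at the good prime `ℓ₁ = 13` (`#Ẽ(𝔽_{13}) = 14`,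
`a = 0`) `X² − aX + 13` is irreducible mod `3`; at `ℓ₂ = 31 ≡ 1 (mod 3)` (`#Ẽ = 30`, `a = 2 ≡ 2`, `9 ∤ 30`) an element of order `3`; point counts by `countPoints_eq_of_fast`
(Sage's `is_surjective(3)` agrees). [cite: Serre1972, §2.8 Prop. 19] [cite: Zywina2015, §1] [cite: Cremona2006, Table 1 (Cremona label 244314bx1)] -/
theorem surj_three_244314bx1 {W : WeierstrassCurve ℚ} [W.IsElliptic] [W.IsGloballyMinimal] (hWeq : W = (⟨1, -1, 1, -56531, -5024141⟩ : WeierstrassCurve ℚ)) : Surj W 3 := by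
  subst hWeq
  haveI : Fact (Nat.Prime 13) := ⟨by norm_num⟩
  haveI : Fact (Nat.Prime 31) := ⟨by norm_num⟩
  have hI : integralModelInt (⟨1, -1, 1, -56531, -5024141⟩ : WeierstrassCurve ℚ) = (⟨1, -1, 1, -56531, -5024141⟩ : WeierstrassCurve ℤ) :=
    integralModelInt_eq_of_map_eq _ (map_mk_int 1 (-1) 1 (-56531) (-5024141))
  have hc₁ : Nat.card ((((⟨1, -1, 1, -56531, -5024141⟩ : WeierstrassCurve ℤ)).map (Int.castRingHom (ZMod 13))).toAffine.Point) = 14 := by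
    exact_mod_cast (natCard_point_eq_countPoints 1 (-1) 1 (-56531) (-5024141) 13 (by norm_num) (by decide +kernel)).trans (countPoints_eq_of_fast (n := 14) (by decide +kernel))
  have hc₂ : Nat.card ((((⟨1, -1, 1, -56531, -5024141⟩ : WeierstrassCurve ℤ)).map (Int.castRingHom (ZMod 31))).toAffine.Point) = 30 := by
    exact_mod_cast (natCard_point_eq_countPoints 1 (-1) 1 (-56531) (-5024141) 31 (by norm_num) (by decide +kernel)).trans (countPoints_eq_of_fast (n := 30) (by decide +kernel))
  exact hasSurjectiveModNGaloisRep_of_intModel_of_irr_of_order hI 3 13 31 (by norm_num) (by norm_num) (by rw [Δ_eq_244314bx1]; norm_num)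
    (by rw [Δ_eq_244314bx1]; norm_num) hc₁ hc₂ (by decide) (by decide) (by decide) (by decide)

/-- **U₁ AT `244314bx1` ON ITS SAVING ROW (inert-set Shimura-curve road, TU|saving)** — `MissingUpperBoundAt W 3` at `W = E` from rhp-p2 g11's shape p674548
`leafRankOneUpper_three_of_shimuraInertDatum_at_saving_of_twistUnit` through the door `leafRankOneUpper_three_at_saving_of_sqrtField`.  PRINTED: `hGZK hmod hnf hJL hCO hPrim`.  KERNEL: `Addv ∧ SubGss` at `3`; `ρ̄₃` onto;
`q₁ = 7 ∣ Δ_min`; `277`, `2` multiplicative; every prime of `Δ_min` enumerated (`krausList_244314bx1`) for `hFC` and for `hshape` off `q₁` (`c = 1` off `Δ_min`, Kodaira–Néron at multiplicative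
primes, Tate certificates at the additive primes `[3]`); (DEG) très ramifié at `s₁ = 277`; the congruences making `277`, `2` inert and the other `ℓ ∣ N` split in
`ℚ(√-251)`; `Cd • E^{(-251)} = Wd`, `Cd = [1, -63, 1/2, 0]`, `Wd` Kraus-minimal.  DISPLAYED: `hN`, `hr`, `Dt`/`hc` (`3 ∤ c(Dt)`), `hLt` (`L(E^{(-251)},1) ≠ 0`),
`hqd`/`hvd` (`#Ш(Wd)_an = 1`).  NO S2 / Σ / L₀.  Per curve; U₁ (26022) stays OPEN class-wide (`BSDp W 3` then by `bsdp_three_of_upper_of_shaAn_unit`); BSD is NOT proved by this.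
[cite: JetchevSkinnerWan2017, §7.4.2 (p. 31)] [cite: PastenShimura2024, Prop. 6.13, Lemma 6.15, Lemma 6.18] [cite: SilvermanAEC2009, VII.5 Prop. 5.1] [cite: Cremona2006, Table 1 (Cremona label 244314bx1)] -/
theorem u1s_at_244314bx1
    (hGZK : rank_eq_analyticRank_of_analyticRank_le_one) (hmod : hasEntireLFunction_rat)
    (hnf : exists_isNewformOf) (hJL : nonempty_shimuraParametrizationData)
    (hCO : PastenShimura2024_componentOrders) (hPrim : shimuraCurve_heegnerSystem_primitivesAtThree)
    {W : WeierstrassCurve ℚ} [W.IsElliptic] [W.IsGloballyMinimal] (hWeq : W = (⟨1, -1, 1, -56531, -5024141⟩ : WeierstrassCurve ℚ))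
    (hN : W.conductorNorm ℤ = 244314) [NeZero (W.conductorNorm ℤ)] (hr : W.analyticRank = 1)
    (Dt : ModularParametrizationData W (W.conductorNorm ℤ)) (hc : ¬ (3 : ℤ) ∣ Dt.c)
    (hLt : (W.quadraticTwist (((-251 : ℤ) : ℚ))).entireLFunction 1 ≠ 0)
    {qd : ℚ} (hqd : haveI := isElliptic_sWd244314bx1; shaAn (⟨1, -1, 0, -3561489843, 79672372352117⟩ : WeierstrassCurve ℚ) = (qd : ℂ))
    (hvd : padicValRat 3 qd ≤ 0) :
    MissingUpperBoundAt W 3 := by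
  subst hWeq
  haveI := isElliptic_sWd244314bx1; haveI := isGloballyMinimal_sWd244314bx1
  have hI : integralModelInt (⟨1, -1, 1, -56531, -5024141⟩ : WeierstrassCurve ℚ) = (⟨1, -1, 1, -56531, -5024141⟩ : WeierstrassCurve ℤ) :=
    integralModelInt_eq_of_map_eq _ (map_mk_int 1 (-1) 1 (-56531) (-5024141))
  have hGS := subGss_three_244314bx1 (W := (⟨1, -1, 1, -56531, -5024141⟩ : WeierstrassCurve ℚ)) rfl
  have hsurj := surj_three_244314bx1 (W := (⟨1, -1, 1, -56531, -5024141⟩ : WeierstrassCurve ℚ)) rfl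
  haveI : Fact ((-251 : ℤ) < 0) := ⟨by norm_num⟩; haveI : Fact (Nat.Prime 7) := ⟨by norm_num⟩
  haveI : Fact (Nat.Prime 277) := ⟨by norm_num⟩; haveI : Fact (Nat.Prime 2) := ⟨by norm_num⟩
  have hbad₁ := WeierstrassCurve.not_hasGoodReductionAtPrime_of_dvd_minimalDiscriminantInt (⟨1, -1, 1, -56531, -5024141⟩ : WeierstrassCurve ℚ) 7 (by rw [IntModel.minimalDiscriminantInt_eq hI, Δ_eq_244314bx1]; norm_num)
  have hm₁ : (⟨1, -1, 1, -56531, -5024141⟩ : WeierstrassCurve ℚ).HasMultiplicativeReductionAtPrime 277 := IntModel.hasMultiplicativeReductionAtPrime_of_intModel hI 277 (by rw [Δ_eq_244314bx1]; norm_num) (by rw [c₄_eq_244314bx1]; norm_num)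
  have hm₂ : (⟨1, -1, 1, -56531, -5024141⟩ : WeierstrassCurve ℚ).HasMultiplicativeReductionAtPrime 2 := IntModel.hasMultiplicativeReductionAtPrime_of_intModel hI 2 (by rw [Δ_eq_244314bx1]; norm_num) (by rw [c₄_eq_244314bx1]; norm_num)
  have hFC : ∀ (ℓ : ℕ) [Fact ℓ.Prime], ℓ ≠ 277 → ℓ ≠ 2 → ℓ ≠ 7 → (⟨1, -1, 1, -56531, -5024141⟩ : WeierstrassCurve ℚ).HasSplitMultiplicativeReductionAtPrime ℓ →
      ¬ 3 ∣ padicValInt ℓ (⟨1, -1, 1, -56531, -5024141⟩ : WeierstrassCurve ℚ).minimalDiscriminantInt := by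
    intro ℓ hℓF hne₁ hne₂ hneq hs
    have hd := dvd_minimalDiscriminantInt_of_mult _ ℓ hs.hasMultiplicativeReductionAtPrime
    rw [IntModel.minimalDiscriminantInt_eq hI, Δ_eq_244314bx1] at hd
    have hmem := mem_of_prime_dvd_of_prodPow_eq _ krausList_244314bx1 hℓF.out hd
    simp only [List.map_cons, List.map_nil, List.mem_cons, List.not_mem_nil, or_false] at hmem
    rcases hmem with rfl | rfl | rfl | rfl
    · exact absurd rfl hne₂
    · exact absurd hs.hasMultiplicativeReductionAtPrime (X9.PrintCert.not_hasMultiplicativeReductionAtPrime_of_dvd_of_dvd hI 3 (by rw [Δ_eq_244314bx1]; norm_num) (by rw [c₄_eq_244314bx1]; norm_num))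
    · exact absurd rfl hneq
    · exact absurd rfl hne₁
  have hshape : ∀ (q : ℕ) [Fact q.Prime], q ≠ 7 → 3 ∣ ((⟨1, -1, 1, -56531, -5024141⟩ : WeierstrassCurve ℚ).baseChange ℚ_[q]).localTamagawaNumber ℤ_[q] →
      (⟨1, -1, 1, -56531, -5024141⟩ : WeierstrassCurve ℚ).HasSplitMultiplicativeReductionAtPrime q := by
    intro q hqF hq h3
    by_cases hd : (q : ℤ) ∣ minimalDiscriminantInt (⟨1, -1, 1, -56531, -5024141⟩ : WeierstrassCurve ℚ)
    swap
    · exact absurd h3 (not_three_dvd_localTamagawaNumber_of_not_dvd _ q hd)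
    rw [IntModel.minimalDiscriminantInt_eq hI, Δ_eq_244314bx1] at hd
    have hmem := mem_of_prime_dvd_of_prodPow_eq _ krausList_244314bx1 hqF.out hd
    simp only [List.map_cons, List.map_nil, List.mem_cons, List.not_mem_nil, or_false] at hmem
    rcases hmem with rfl | rfl | rfl | rfl
    · exact (Koly.split_and_three_dvd_of_mult_of_three_dvd_localTamagawaNumber _ 2 (IntModel.hasMultiplicativeReductionAtPrime_of_intModel hI 2 (by rw [Δ_eq_244314bx1]; norm_num) (by rw [c₄_eq_244314bx1]; norm_num)) h3).1
    · have hc3 : ((⟨1, -1, 1, -56531, -5024141⟩ : WeierstrassCurve ℚ).baseChange ℚ_[3]).localTamagawaNumber ℤ_[3] = 2 := -- additive `3` (I0*): Tate certificate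
        (IntModelTam.localTamagawaNumber_padic_eq_of_intModel_of_tamZ hI 3 (F := ⟨3, 9, 1, 1, 8, 6, 0, 1⟩) rfl (by decide +kernel)).trans (by decide)
      rw [hc3] at h3; exact absurd h3 (by decide)
    · exact absurd rfl hq
    · exact (Koly.split_and_three_dvd_of_mult_of_three_dvd_localTamagawaNumber _ 277 (IntModel.hasMultiplicativeReductionAtPrime_of_intModel hI 277 (by rw [Δ_eq_244314bx1]; norm_num) (by rw [c₄_eq_244314bx1]; norm_num)) h3).1
  have hjac : ∀ ℓ : ℕ, ℓ.Prime → ℓ ∣ (⟨1, -1, 1, -56531, -5024141⟩ : WeierstrassCurve ℚ).conductorNorm ℤ → ℓ ≠ 277 → ℓ ≠ 2 → ℓ ≠ 2 →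
      jacobiSym (-251) ℓ = 1 := by
    intro ℓ hℓ hℓN hne₁ hne₂ hℓ2
    rw [hN] at hℓN
    have hmem : ℓ ∈ Nat.primeFactors 244314 := Nat.mem_primeFactors.mpr ⟨hℓ, hℓN, by norm_num⟩
    rw [show Nat.primeFactors 244314 = {2, 3, 7, 277} by decide +kernel] at hmem
    simp only [Finset.mem_insert, Finset.mem_singleton] at hmem
    rcases hmem with rfl | rfl | rfl | rfl
    · exact absurd rfl hne₂
    · norm_num [jacobiSym.mod_left]
    · norm_num [jacobiSym.mod_left]
    · exact absurd rfl hne₁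
  have hWd : (⟨1, (-63 : ℚ), ((1:ℚ)/2), (0 : ℚ)⟩ : VariableChange ℚ) • (⟨1, -1, 1, -56531, -5024141⟩ : WeierstrassCurve ℚ).quadraticTwist (((-251 : ℤ) : ℚ)) =
      (⟨1, -1, 0, -3561489843, 79672372352117⟩ : WeierstrassCurve ℚ) := by
    push_cast; ext <;> simp [WeierstrassCurve.variableChange_a₁, WeierstrassCurve.variableChange_a₂,
      WeierstrassCurve.variableChange_a₃, WeierstrassCurve.variableChange_a₄, WeierstrassCurve.variableChange_a₆,
      WeierstrassCurve.quadraticTwist, WeierstrassCurve.b₂, WeierstrassCurve.b₄, WeierstrassCurve.b₆] <;> norm_num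
  exact leafRankOneUpper_three_at_saving_of_sqrtField hGZK hmod hnf hJL hCO hPrim _ hGS.1 hGS.2 hr hsurj rfl Dt hc 7 hbad₁
    (s₁ := 277) (s₂ := 2) (by decide) (by decide) (by decide) hm₁ hm₂ hFC hshape
    (Or.inl (by rw [IntModel.minimalDiscriminantInt_eq hI, Δ_eq_244314bx1, IntModel.padicValInt_eq_of_dvd_of_not_dvd 277 (e := 1) (by norm_num) (by norm_num)]; decide))
    (-251) (by norm_num) (by rw [show (-251 : ℤ).natAbs = 251 by rfl, Nat.squarefree_iff_nodup_primeFactorsList (by norm_num)]; simp)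
    (Or.inr ⟨by decide, by norm_num [jacobiSym.mod_left]⟩) (by norm_num) (Or.inl ⟨rfl, by norm_num⟩) (by norm_num) hjac
    (fun _ _ h ↦ absurd rfl h) hLt _ _ hWd hqd hvd

/-! ## §34 `255915bd1` = `[0, 0, 1, 23958, 296480]`, `N = 255915 = 3^2·5·11^2·47` (`3`: I₀*, `c = 2`, `5`: I3, `c = 3`, split, `11`: IV*, `c = 3`, `47`: I1, `c = 1`, split); exempted carrier `q₁ = 11` (additive IV*, `c = 3`), inert set `S = {47, 5}` (multiplicative), (DEG) très ramifié at `s₁ = 47` (`3 ∤ ord_{47} Δ = 1`);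
`ρ̄₃` onto (certificate primes `ℓ₁ = 17`, `#Ẽ(𝔽_{17}) = 16`; `ℓ₂ = 31`, `#Ẽ(𝔽_{31}) = 30`); `r_an = 1`, `#E(ℚ)_tors = 1`, `∏ c_ℓ = 18`, `#Ш(E)_an = 1` (Cremona/LMFDB, displayed where used); class `255915bd` of size 1.
`V = E^{(-3)}_min = [0, 0, 1, 2662, -10981]` (`#Ṽ(𝔽₃) = 4`).  JSW field `K = ℚ(√-83)` (`83` prime; `47`, `5` inert, every other `ℓ ∣ N` split): the least such `D` with a twist unit (kit j322550: `L(E^{(-83)},1)/Ω = 12 ≠ 0`, root no. `+1`, `Wd = E^{(-83)}_min = [0, 0, 1, 165046662, -169523552707]`, `N(Wd) = 1762998435`, `∏c = 12`, `T = 1`, `#Ш(Wd)_an = (L/Ω)T²/∏c = 1` exactly). -/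

/-- `V = [0, 0, 1, 2662, -10981]` (the minimal model of `255915bd1^{(-3)}`, conductor `28435`): `Δ ≠ 0` in the kernel. [cite: Cremona2006, Table 1 (Cremona label 255915bd1)] -/
theorem isElliptic_sV255915bd1 : (⟨0, 0, 1, 2662, -10981⟩ : WeierstrassCurve ℚ).IsElliptic :=
  isElliptic_of_discOf_ne_zero 0 0 1 2662 (-10981) (by decide +kernel)

/-- `V` is globally minimal: `|Δ| = 5^3·11^8·47` kernel-checked, Kraus' criterion prime by prime. [cite: Kraus1989, Prop. 1 and Prop. 2]
[cite: SilvermanAEC2009, VII.1 Remark 1.1] [cite: Cremona2006, Table 1 (Cremona label 255915bd1)] -/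
theorem isGloballyMinimal_sV255915bd1 : (⟨0, 0, 1, 2662, -10981⟩ : WeierstrassCurve ℚ).IsGloballyMinimal :=
  isGloballyMinimal_of_krausCriterion₃_factored 0 0 1 2662 (-10981)
    [(5, 3), (11, 8), (47, 1)] (by decide +kernel)
    (by intro qe hqe; simp only [List.mem_cons, List.not_mem_nil, or_false] at hqe
        rcases hqe with rfl | rfl | rfl <;> norm_num)
    (by set_option synthInstance.maxSize 2000 in decide +kernel)

/-- `Wd = [0, 0, 1, 165046662, -169523552707]` (the minimal model of the twist `255915bd1^{(-83)}`, conductor `1762998435`): `Δ ≠ 0` in the kernel. [cite: Cremona2006, Table 1 (Cremona label 255915bd1)] -/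
theorem isElliptic_sWd255915bd1 : (⟨0, 0, 1, 165046662, -169523552707⟩ : WeierstrassCurve ℚ).IsElliptic :=
  isElliptic_of_discOf_ne_zero 0 0 1 165046662 (-169523552707) (by decide +kernel)

/-- `Wd` is globally minimal: `|Δ| = 3^6·5^3·11^8·47·83^6` kernel-checked, Kraus' criterion prime by prime. [cite: Kraus1989, Prop. 1 and Prop. 2]
[cite: SilvermanAEC2009, VII.1 Remark 1.1] [cite: Cremona2006, Table 1 (Cremona label 255915bd1)] -/
theorem isGloballyMinimal_sWd255915bd1 : (⟨0, 0, 1, 165046662, -169523552707⟩ : WeierstrassCurve ℚ).IsGloballyMinimal :=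
  isGloballyMinimal_of_krausCriterion₃_factored 0 0 1 165046662 (-169523552707)
    [(3, 6), (5, 3), (11, 8), (47, 1), (83, 6)] (by decide +kernel)
    (by intro qe hqe; simp only [List.mem_cons, List.not_mem_nil, or_false] at hqe
        rcases hqe with rfl | rfl | rfl | rfl | rfl <;> norm_num)
    (by set_option synthInstance.maxSize 2000 in decide +kernel)

/-- **`255915bd1` is ADDITIVE at `3` and on the cell (G) ∧ ss, IN THE KERNEL**: `3 ∣ Δ`, `3 ∣ c₄`; `C • V^{(-3)} = E` (`[u, r, s, t] = [1, 0, 0, 1/2]`) with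
`V` globally minimal, `3 ∤ Δ(V)`, `#Ṽ(𝔽₃) = 4` (`a₃(V) = 0`, supersingular), whence `TypeG`, `SubGord`, `SubGss` at `3` (g13's block, unchanged).
[cite: SilvermanAEC2009, VII.5 Prop. 5.1 (a), (c)] [cite: Delbourgo1998, §1.5 (G)] [cite: Cremona2006, Table 1 (Cremona label 255915bd1)] -/
theorem subGss_three_255915bd1 {W : WeierstrassCurve ℚ} [W.IsElliptic] [W.IsGloballyMinimal] (hWeq : W = (⟨0, 0, 1, 23958, 296480⟩ : WeierstrassCurve ℚ)) :
    Addv W 3 ∧ SubGss W 3 := by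
  subst hWeq
  haveI := isElliptic_sV255915bd1
  haveI := isGloballyMinimal_sV255915bd1
  have hIW : integralModelInt (⟨0, 0, 1, 23958, 296480⟩ : WeierstrassCurve ℚ) = (⟨0, 0, 1, 23958, 296480⟩ : WeierstrassCurve ℤ) :=
    integralModelInt_eq_of_map_eq _ (map_mk_int 0 0 1 23958 296480)
  have hadd : Addv (⟨0, 0, 1, 23958, 296480⟩ : WeierstrassCurve ℚ) 3 := Additive.addv_of_intModel hIW 3 (by decide +kernel) (by decide +kernel)
  have hIV : integralModelInt (⟨0, 0, 1, 2662, -10981⟩ : WeierstrassCurve ℚ) = (⟨0, 0, 1, 2662, -10981⟩ : WeierstrassCurve ℤ) :=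
    integralModelInt_eq_of_map_eq _ (map_mk_int 0 0 1 2662 (-10981))
  have hcV : Nat.card ((((⟨0, 0, 1, 2662, -10981⟩ : WeierstrassCurve ℤ)).map (Int.castRingHom (ZMod 3))).toAffine.Point) = 4 := by
    have h := natCard_point_eq_countPoints 0 0 1 2662 (-10981) 3 (by norm_num) (by decide +kernel)
    have h' : countPoints [0, 0, 1, 2662, -10981] 3 = 4 := countPoints_eq_of_fast (by decide +kernel)
    exact_mod_cast h.trans h'
  have hgood : GoodSS (⟨0, 0, 1, 2662, -10981⟩ : WeierstrassCurve ℚ) 3 := Supersingular.goodSS_of_intModel 3 hIV (by decide +kernel) hcV (by decide)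
  have hVW : (⟨1, (0 : ℚ), (0 : ℚ), ((1:ℚ)/2)⟩ : VariableChange ℚ) • (⟨0, 0, 1, 2662, -10981⟩ : WeierstrassCurve ℚ).quadraticTwist (-3) =
      (⟨0, 0, 1, 23958, 296480⟩ : WeierstrassCurve ℚ) := by
    ext <;> simp [WeierstrassCurve.variableChange_a₁, WeierstrassCurve.variableChange_a₂,
      WeierstrassCurve.variableChange_a₃, WeierstrassCurve.variableChange_a₄, WeierstrassCurve.variableChange_a₆,
      WeierstrassCurve.quadraticTwist, WeierstrassCurve.b₂, WeierstrassCurve.b₄, WeierstrassCurve.b₆] <;> norm_num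
  obtain ⟨C, hC⟩ := exists_variableChange_quadraticTwist_symm (⟨0, 0, 1, 23958, 296480⟩ : WeierstrassCurve ℚ)
    (⟨0, 0, 1, 2662, -10981⟩ : WeierstrassCurve ℚ) (d := (-3 : ℚ)) (by norm_num) ⟨_, hVW⟩
  have hC' : C • (⟨0, 0, 1, 23958, 296480⟩ : WeierstrassCurve ℚ).quadraticTwist ((-1 : ℚ) ^ ((3 : ℕ) / 2) * (3 : ℕ)) =
      (⟨0, 0, 1, 2662, -10981⟩ : WeierstrassCurve ℚ) := by
    rw [O5.pstar_three]; exact hC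
  have hG : TypeG (⟨0, 0, 1, 23958, 296480⟩ : WeierstrassCurve ℚ) 3 := (typeG_three_iff_good_twist _ hadd _ C hC').mpr hgood.1
  exact ⟨hadd, (O5.subGss_three_iff_subGord_and_goodSS_twist _ hadd _ C hC).mpr
    ⟨subGord_three_of_typeG_of_addv _ hG hadd, hgood⟩⟩

/-- `Δ(E₀) = -918072292462875 = -3^6·5^3·11^8·47` on the integer equation of `255915bd1`. [cite: Cremona2006, Table 1 (Cremona label 255915bd1)] -/
theorem Δ_eq_255915bd1 : (⟨0, 0, 1, 23958, 296480⟩ : WeierstrassCurve ℤ).Δ = -918072292462875 := by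
  norm_num [WeierstrassCurve.Δ, WeierstrassCurve.b₂, WeierstrassCurve.b₄, WeierstrassCurve.b₆, WeierstrassCurve.b₈]

/-- `c₄(E₀) = -1149984` on the integer equation of `255915bd1`. [cite: Cremona2006, Table 1 (Cremona label 255915bd1)] -/
theorem c₄_eq_255915bd1 : (⟨0, 0, 1, 23958, 296480⟩ : WeierstrassCurve ℤ).c₄ = -1149984 := by
  norm_num [WeierstrassCurve.c₄, WeierstrassCurve.b₂, WeierstrassCurve.b₄]

/-- The Kraus list of `255915bd1` consists of primes and multiplies to `|Δ(E₀)|`, IN THE KERNEL: a prime dividing `Δ_min` is one of `[3, 5, 11, 47]`. [cite: Cremona2006, Table 1 (Cremona label 255915bd1)] -/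
theorem krausList_255915bd1 : (∀ qe ∈ ([(3, 6), (5, 3), (11, 8), (47, 1)] : List (ℕ × ℕ)), qe.1.Prime) ∧
    (([(3, 6), (5, 3), (11, 8), (47, 1)] : List (ℕ × ℕ)).map fun qe => qe.1 ^ qe.2).prod = (-918072292462875 : ℤ).natAbs :=
  ⟨by decide +kernel, by decide +kernel⟩

/-- **`ρ̄_{E,3}` ONTO for `255915bd1`, IN THE KERNEL** (Frobenius-order witness `hasSurjectiveModNGaloisRep_of_intModel_of_irr_of_order`): at the good prime `ℓ₁ = 17` (`#Ẽ(𝔽_{17}) = 16`,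
`a = 2`) `X² − aX + 17` is irreducible mod `3`; at `ℓ₂ = 31 ≡ 1 (mod 3)` (`#Ẽ = 30`, `a = 2 ≡ 2`, `9 ∤ 30`) an element of order `3`; point counts by `countPoints_eq_of_fast`
(Sage's `is_surjective(3)` agrees). [cite: Serre1972, §2.8 Prop. 19] [cite: Zywina2015, §1] [cite: Cremona2006, Table 1 (Cremona label 255915bd1)] -/
theorem surj_three_255915bd1 {W : WeierstrassCurve ℚ} [W.IsElliptic] [W.IsGloballyMinimal] (hWeq : W = (⟨0, 0, 1, 23958, 296480⟩ : WeierstrassCurve ℚ)) : Surj W 3 := by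
  subst hWeq
  haveI : Fact (Nat.Prime 17) := ⟨by norm_num⟩
  haveI : Fact (Nat.Prime 31) := ⟨by norm_num⟩
  have hI : integralModelInt (⟨0, 0, 1, 23958, 296480⟩ : WeierstrassCurve ℚ) = (⟨0, 0, 1, 23958, 296480⟩ : WeierstrassCurve ℤ) :=
    integralModelInt_eq_of_map_eq _ (map_mk_int 0 0 1 23958 296480)
  have hc₁ : Nat.card ((((⟨0, 0, 1, 23958, 296480⟩ : WeierstrassCurve ℤ)).map (Int.castRingHom (ZMod 17))).toAffine.Point) = 16 := by
    exact_mod_cast (natCard_point_eq_countPoints 0 0 1 23958 296480 17 (by norm_num) (by decide +kernel)).trans (countPoints_eq_of_fast (n := 16) (by decide +kernel))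
  have hc₂ : Nat.card ((((⟨0, 0, 1, 23958, 296480⟩ : WeierstrassCurve ℤ)).map (Int.castRingHom (ZMod 31))).toAffine.Point) = 30 := by
    exact_mod_cast (natCard_point_eq_countPoints 0 0 1 23958 296480 31 (by norm_num) (by decide +kernel)).trans (countPoints_eq_of_fast (n := 30) (by decide +kernel))
  exact hasSurjectiveModNGaloisRep_of_intModel_of_irr_of_order hI 3 17 31 (by norm_num) (by norm_num) (by rw [Δ_eq_255915bd1]; norm_num)
    (by rw [Δ_eq_255915bd1]; norm_num) hc₁ hc₂ (by decide) (by decide) (by decide) (by decide)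

/-- **U₁ AT `255915bd1` ON ITS SAVING ROW (inert-set Shimura-curve road, TU|saving)** — `MissingUpperBoundAt W 3` at `W = E` from rhp-p2 g11's shape p674548
`leafRankOneUpper_three_of_shimuraInertDatum_at_saving_of_twistUnit` through the door `leafRankOneUpper_three_at_saving_of_sqrtField`.  PRINTED: `hGZK hmod hnf hJL hCO hPrim`.  KERNEL: `Addv ∧ SubGss` at `3`; `ρ̄₃` onto;
`q₁ = 11 ∣ Δ_min`; `47`, `5` multiplicative; every prime of `Δ_min` enumerated (`krausList_255915bd1`) for `hFC` and for `hshape` off `q₁` (`c = 1` off `Δ_min`, Kodaira–Néron at multiplicative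
primes, Tate certificates at the additive primes `[3]`); (DEG) très ramifié at `s₁ = 47`; the congruences making `47`, `5` inert and the other `ℓ ∣ N` split in
`ℚ(√-83)`; `Cd • E^{(-83)} = Wd`, `Cd = [1, 0, 0, 1/2]`, `Wd` Kraus-minimal.  DISPLAYED: `hN`, `hr`, `Dt`/`hc` (`3 ∤ c(Dt)`), `hLt` (`L(E^{(-83)},1) ≠ 0`),
`hqd`/`hvd` (`#Ш(Wd)_an = 1`).  NO S2 / Σ / L₀.  Per curve; U₁ (26022) stays OPEN class-wide (`BSDp W 3` then by `bsdp_three_of_upper_of_shaAn_unit`); BSD is NOT proved by this.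
[cite: JetchevSkinnerWan2017, §7.4.2 (p. 31)] [cite: PastenShimura2024, Prop. 6.13, Lemma 6.15, Lemma 6.18] [cite: SilvermanAEC2009, VII.5 Prop. 5.1] [cite: Cremona2006, Table 1 (Cremona label 255915bd1)] -/
theorem u1s_at_255915bd1
    (hGZK : rank_eq_analyticRank_of_analyticRank_le_one) (hmod : hasEntireLFunction_rat)
    (hnf : exists_isNewformOf) (hJL : nonempty_shimuraParametrizationData)
    (hCO : PastenShimura2024_componentOrders) (hPrim : shimuraCurve_heegnerSystem_primitivesAtThree)
    {W : WeierstrassCurve ℚ} [W.IsElliptic] [W.IsGloballyMinimal] (hWeq : W = (⟨0, 0, 1, 23958, 296480⟩ : WeierstrassCurve ℚ))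
    (hN : W.conductorNorm ℤ = 255915) [NeZero (W.conductorNorm ℤ)] (hr : W.analyticRank = 1)
    (Dt : ModularParametrizationData W (W.conductorNorm ℤ)) (hc : ¬ (3 : ℤ) ∣ Dt.c)
    (hLt : (W.quadraticTwist (((-83 : ℤ) : ℚ))).entireLFunction 1 ≠ 0)
    {qd : ℚ} (hqd : haveI := isElliptic_sWd255915bd1; shaAn (⟨0, 0, 1, 165046662, -169523552707⟩ : WeierstrassCurve ℚ) = (qd : ℂ))
    (hvd : padicValRat 3 qd ≤ 0) :
    MissingUpperBoundAt W 3 := by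
  subst hWeq
  haveI := isElliptic_sWd255915bd1; haveI := isGloballyMinimal_sWd255915bd1
  have hI : integralModelInt (⟨0, 0, 1, 23958, 296480⟩ : WeierstrassCurve ℚ) = (⟨0, 0, 1, 23958, 296480⟩ : WeierstrassCurve ℤ) :=
    integralModelInt_eq_of_map_eq _ (map_mk_int 0 0 1 23958 296480)
  have hGS := subGss_three_255915bd1 (W := (⟨0, 0, 1, 23958, 296480⟩ : WeierstrassCurve ℚ)) rfl
  have hsurj := surj_three_255915bd1 (W := (⟨0, 0, 1, 23958, 296480⟩ : WeierstrassCurve ℚ)) rfl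
  haveI : Fact ((-83 : ℤ) < 0) := ⟨by norm_num⟩; haveI : Fact (Nat.Prime 11) := ⟨by norm_num⟩
  haveI : Fact (Nat.Prime 47) := ⟨by norm_num⟩; haveI : Fact (Nat.Prime 5) := ⟨by norm_num⟩
  have hbad₁ := WeierstrassCurve.not_hasGoodReductionAtPrime_of_dvd_minimalDiscriminantInt (⟨0, 0, 1, 23958, 296480⟩ : WeierstrassCurve ℚ) 11 (by rw [IntModel.minimalDiscriminantInt_eq hI, Δ_eq_255915bd1]; norm_num)
  have hm₁ : (⟨0, 0, 1, 23958, 296480⟩ : WeierstrassCurve ℚ).HasMultiplicativeReductionAtPrime 47 := IntModel.hasMultiplicativeReductionAtPrime_of_intModel hI 47 (by rw [Δ_eq_255915bd1]; norm_num) (by rw [c₄_eq_255915bd1]; norm_num)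
  have hm₂ : (⟨0, 0, 1, 23958, 296480⟩ : WeierstrassCurve ℚ).HasMultiplicativeReductionAtPrime 5 := IntModel.hasMultiplicativeReductionAtPrime_of_intModel hI 5 (by rw [Δ_eq_255915bd1]; norm_num) (by rw [c₄_eq_255915bd1]; norm_num)
  have hFC : ∀ (ℓ : ℕ) [Fact ℓ.Prime], ℓ ≠ 47 → ℓ ≠ 5 → ℓ ≠ 11 → (⟨0, 0, 1, 23958, 296480⟩ : WeierstrassCurve ℚ).HasSplitMultiplicativeReductionAtPrime ℓ →
      ¬ 3 ∣ padicValInt ℓ (⟨0, 0, 1, 23958, 296480⟩ : WeierstrassCurve ℚ).minimalDiscriminantInt := by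
    intro ℓ hℓF hne₁ hne₂ hneq hs
    have hd := dvd_minimalDiscriminantInt_of_mult _ ℓ hs.hasMultiplicativeReductionAtPrime
    rw [IntModel.minimalDiscriminantInt_eq hI, Δ_eq_255915bd1] at hd
    have hmem := mem_of_prime_dvd_of_prodPow_eq _ krausList_255915bd1 hℓF.out hd
    simp only [List.map_cons, List.map_nil, List.mem_cons, List.not_mem_nil, or_false] at hmem
    rcases hmem with rfl | rfl | rfl | rfl
    · exact absurd hs.hasMultiplicativeReductionAtPrime (X9.PrintCert.not_hasMultiplicativeReductionAtPrime_of_dvd_of_dvd hI 3 (by rw [Δ_eq_255915bd1]; norm_num) (by rw [c₄_eq_255915bd1]; norm_num))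
    · exact absurd rfl hne₂
    · exact absurd rfl hneq
    · exact absurd rfl hne₁
  have hshape : ∀ (q : ℕ) [Fact q.Prime], q ≠ 11 → 3 ∣ ((⟨0, 0, 1, 23958, 296480⟩ : WeierstrassCurve ℚ).baseChange ℚ_[q]).localTamagawaNumber ℤ_[q] →
      (⟨0, 0, 1, 23958, 296480⟩ : WeierstrassCurve ℚ).HasSplitMultiplicativeReductionAtPrime q := by
    intro q hqF hq h3
    by_cases hd : (q : ℤ) ∣ minimalDiscriminantInt (⟨0, 0, 1, 23958, 296480⟩ : WeierstrassCurve ℚ)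
    swap
    · exact absurd h3 (not_three_dvd_localTamagawaNumber_of_not_dvd _ q hd)
    rw [IntModel.minimalDiscriminantInt_eq hI, Δ_eq_255915bd1] at hd
    have hmem := mem_of_prime_dvd_of_prodPow_eq _ krausList_255915bd1 hqF.out hd
    simp only [List.map_cons, List.map_nil, List.mem_cons, List.not_mem_nil, or_false] at hmem
    rcases hmem with rfl | rfl | rfl | rfl
    · have hc3 : ((⟨0, 0, 1, 23958, 296480⟩ : WeierstrassCurve ℚ).baseChange ℚ_[3]).localTamagawaNumber ℤ_[3] = 2 := -- additive `3` (I0*): Tate certificate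
        (IntModelTam.localTamagawaNumber_padic_eq_of_intModel_of_tamZ hI 3 (F := ⟨3, 9, 0, 0, 4, 6, 0, 1⟩) rfl (by decide +kernel)).trans (by decide)
      rw [hc3] at h3; exact absurd h3 (by decide)
    · exact (Koly.split_and_three_dvd_of_mult_of_three_dvd_localTamagawaNumber _ 5 (IntModel.hasMultiplicativeReductionAtPrime_of_intModel hI 5 (by rw [Δ_eq_255915bd1]; norm_num) (by rw [c₄_eq_255915bd1]; norm_num)) h3).1
    · exact absurd rfl hq
    · exact (Koly.split_and_three_dvd_of_mult_of_three_dvd_localTamagawaNumber _ 47 (IntModel.hasMultiplicativeReductionAtPrime_of_intModel hI 47 (by rw [Δ_eq_255915bd1]; norm_num) (by rw [c₄_eq_255915bd1]; norm_num)) h3).1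
  have hjac : ∀ ℓ : ℕ, ℓ.Prime → ℓ ∣ (⟨0, 0, 1, 23958, 296480⟩ : WeierstrassCurve ℚ).conductorNorm ℤ → ℓ ≠ 47 → ℓ ≠ 5 → ℓ ≠ 2 →
      jacobiSym (-83) ℓ = 1 := by
    intro ℓ hℓ hℓN hne₁ hne₂ hℓ2
    rw [hN] at hℓN
    have hmem : ℓ ∈ Nat.primeFactors 255915 := Nat.mem_primeFactors.mpr ⟨hℓ, hℓN, by norm_num⟩
    rw [show Nat.primeFactors 255915 = {3, 5, 11, 47} by decide +kernel] at hmem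
    simp only [Finset.mem_insert, Finset.mem_singleton] at hmem
    rcases hmem with rfl | rfl | rfl | rfl
    · norm_num [jacobiSym.mod_left]
    · exact absurd rfl hne₂
    · norm_num [jacobiSym.mod_left]
    · exact absurd rfl hne₁
  have hWd : (⟨1, (0 : ℚ), (0 : ℚ), ((1:ℚ)/2)⟩ : VariableChange ℚ) • (⟨0, 0, 1, 23958, 296480⟩ : WeierstrassCurve ℚ).quadraticTwist (((-83 : ℤ) : ℚ)) =
      (⟨0, 0, 1, 165046662, -169523552707⟩ : WeierstrassCurve ℚ) := by
    push_cast; ext <;> simp [WeierstrassCurve.variableChange_a₁, WeierstrassCurve.variableChange_a₂,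
      WeierstrassCurve.variableChange_a₃, WeierstrassCurve.variableChange_a₄, WeierstrassCurve.variableChange_a₆,
      WeierstrassCurve.quadraticTwist, WeierstrassCurve.b₂, WeierstrassCurve.b₄, WeierstrassCurve.b₆] <;> norm_num
  exact leafRankOneUpper_three_at_saving_of_sqrtField hGZK hmod hnf hJL hCO hPrim _ hGS.1 hGS.2 hr hsurj rfl Dt hc 11 hbad₁
    (s₁ := 47) (s₂ := 5) (by decide) (by decide) (by decide) hm₁ hm₂ hFC hshape
    (Or.inl (by rw [IntModel.minimalDiscriminantInt_eq hI, Δ_eq_255915bd1, IntModel.padicValInt_eq_of_dvd_of_not_dvd 47 (e := 1) (by norm_num) (by norm_num)]; decide))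
    (-83) (by norm_num) (by rw [show (-83 : ℤ).natAbs = 83 by rfl, Nat.squarefree_iff_nodup_primeFactorsList (by norm_num)]; simp)
    (Or.inr ⟨by decide, by norm_num [jacobiSym.mod_left]⟩) (by norm_num) (Or.inr ⟨by decide, by norm_num [jacobiSym.mod_left]⟩) (by norm_num) hjac
    (fun h _ _ ↦ by rw [hN] at h; norm_num at h) hLt _ _ hWd hqd hvd

end Summit.BirchSwinnertonDyer.BirchSwinnertonDyer.Theorems.RamifiedHeegnerPairTwistUnitSaving

end
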